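import Mathlib
import Literature.NumberTheory.Automorphic.HyperbolicLaplaceSpectrum

/-!
# `C²` and the hyperbolic Laplacian transport under the reflection `z ↦ -z̄`

Stub P2a `stub_reflect_laplacian` of line `Sketch` (crux stmt-Langlands-15897,
`Summit.Langlands.Langlands.Theses.QuarterDeficit1951.QuarterFingerprintDeficit`), kernel-proved.

For `u : ℍ → ℂ` with `IsC2 u` (the extension `u ∘ ofComplex` is `C²` on the open upper half-plane):
`u ∘ R` is again `C²` there and `Δ(u ∘ R)(z) = (Δ u)(R z)` for Iwaniec's `Δ = y²(∂ₓ² + ∂_y²)`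
(`Literature.NumberTheory.Automorphic.hypLaplacian`), where `R z = -z̄ = UpperHalfPlane.J • z`.
Proof: on the open half-plane `(u ∘ R) ∘ ofComplex` agrees with `(u ∘ ofComplex) ∘ L` for the real-linear
ISOMETRY `L w = -w̄` (`Complex.conjLIE.trans (LinearIsometryEquiv.neg ℝ)`); the Euclidean Laplacian is
invariant under linear isometries (computed in the orthonormal basis `v` and its image `v.map L`, with
`ContinuousLinearEquiv.iteratedFDerivWithin_comp_right`), and `Im (R z) = Im z`.

All auxiliary lemmas are `private` and live in the sub-namespace `ReflectLaplacianAux`; the file introduces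
no definition, and exports only
`Summit.Langlands.Langlands.Theorems.QuarterFingerprintDeficit.stub_reflect_laplacian`.
-/

set_option linter.dupNamespace false

noncomputable section

namespace Summit.Langlands.Langlands.Theorems.QuarterFingerprintDeficit

open scoped MatrixGroups ComplexConjugate InnerProductSpace
open UpperHalfPlane Laplacian

namespace ReflectLaplacianAux

/-- The reflection `w ↦ -w̄` of `ℂ` is (the underlying map of) a real-linear isometry. [folklore] -/
private theorem exists_linearIsometryEquiv_neg_conj :
    ∃ L : ℂ ≃ₗᵢ[ℝ] ℂ, ∀ w, L w = -conj w :=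
  ⟨Complex.conjLIE.trans (LinearIsometryEquiv.neg ℝ), fun w => by
    simp [LinearIsometryEquiv.trans_apply, LinearIsometryEquiv.coe_neg]⟩

/-- The Euclidean Laplacian on `ℂ ≅ ℝ²` is invariant under real-linear isometries:
`Δ (f ∘ L) x = (Δ f) (L x)` (no differentiability hypothesis). [folklore] -/
private theorem laplacian_comp_linearIsometryEquiv (f : ℂ → ℂ) (L : ℂ ≃ₗᵢ[ℝ] ℂ) (x : ℂ) :
    (Δ (f ∘ L)) x = (Δ f) (L x) := by
  set v := Complex.orthonormalBasisOneI with hv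
  have h1 := congrFun (InnerProductSpace.laplacian_eq_iteratedFDeriv_orthonormalBasis (f ∘ L) v) x
  have h2 := congrFun (InnerProductSpace.laplacian_eq_iteratedFDeriv_orthonormalBasis f (v.map L)) (L x)
  rw [h1, h2]
  refine Finset.sum_congr rfl fun i _ => ?_
  have h := L.toContinuousLinearEquiv.iteratedFDerivWithin_comp_right f uniqueDiffOn_univ
    (Set.mem_univ (L.toContinuousLinearEquiv x)) 2
  simp only [Set.preimage_univ, iteratedFDerivWithin_univ,
    LinearIsometryEquiv.coe_toContinuousLinearEquiv] at h
  rw [h, ContinuousMultilinearMap.compContinuousLinearMap_apply, OrthonormalBasis.map_apply]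
  congr 1
  funext j
  fin_cases j <;> simp

/-- On the open upper half-plane, `(u ∘ R) ∘ ofComplex = (u ∘ ofComplex) ∘ L` for any map `L` with
`L w = -w̄`. [folklore] -/
private theorem comp_J_ofComplex_eq (L : ℂ ≃ₗᵢ[ℝ] ℂ) (hL : ∀ w, L w = -conj w) (u : ℍ → ℂ) {w : ℂ}
    (hw : 0 < w.im) : ((fun z => u (J • z)) ∘ ofComplex) w = ((u ∘ ofComplex) ∘ L) w := by
  have h2 : 0 < (-conj w).im := by simpa using hw
  simp only [Function.comp_apply, hL]
  congr 1
  apply UpperHalfPlane.ext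
  rw [coe_J_smul, ofComplex_apply_of_im_pos hw, ofComplex_apply_of_im_pos h2, coe_mk, coe_mk]

/-- `IsC2` and `hypLaplacian` transport under `R : z ↦ -z̄` (auxiliary form of the stub, proved via
a real-linear isometry `L` with `L w = -w̄`). [folklore] -/
private theorem reflect_laplacian_aux (u : ℍ → ℂ) (hu : Literature.NumberTheory.Automorphic.IsC2 u) :
    Literature.NumberTheory.Automorphic.IsC2 (fun z => u (J • z)) ∧
    ∀ z : ℍ,
      Literature.NumberTheory.Automorphic.hypLaplacian (fun w => u (J • w)) z =
      Literature.NumberTheory.Automorphic.hypLaplacian u (J • z) := by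
  obtain ⟨L, hL⟩ := exists_linearIsometryEquiv_neg_conj
  have hmaps : Set.MapsTo (L : ℂ → ℂ) {w : ℂ | 0 < w.im} {w : ℂ | 0 < w.im} := by
    intro w hw
    simpa [hL] using hw
  constructor
  · -- C² : compose with the isometry, then correct on the open set
    unfold Literature.NumberTheory.Automorphic.IsC2 at hu ⊢
    have hcomp : ContDiffOn ℝ 2 ((u ∘ ofComplex) ∘ L) {w : ℂ | 0 < w.im} :=
      hu.comp L.contDiff.contDiffOn hmaps
    exact hcomp.congr fun w hw => comp_J_ofComplex_eq L hL u hw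
  · intro z
    unfold Literature.NumberTheory.Automorphic.hypLaplacian
    have him : (J • z).im = z.im := by
      rw [← coe_im, coe_J_smul]; simp
    rw [him]
    congr 1
    -- Laplacians agree: local equality of the functions near `z`, then isometry invariance
    have hopen : IsOpen {w : ℂ | 0 < w.im} := isOpen_lt continuous_const Complex.continuous_im
    have hev : ((fun w => u (J • w)) ∘ ofComplex) =ᶠ[nhds (z : ℂ)] ((u ∘ ofComplex) ∘ L) := by
      filter_upwards [hopen.mem_nhds z.im_pos] with w hw
      exact comp_J_ofComplex_eq L hL u hw
    rw [(InnerProductSpace.laplacian_congr_nhds hev).eq_of_nhds, laplacian_comp_linearIsometryEquiv,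
      hL, coe_J_smul]

end ReflectLaplacianAux

/-- **Stub P2a (proved).** For `u : ℍ → ℂ` whose extension `u ∘ ofComplex` is `C²` on the open upper
half-plane, the reflected function `z ↦ u (-z̄)` (`-z̄ = UpperHalfPlane.J • z`) is again `C²` there, and
Iwaniec's hyperbolic Laplacian commutes with the reflection: `Δ (u ∘ R) z = (Δ u) (R z)`. [folklore] -/
theorem stub_reflect_laplacian (u : UpperHalfPlane → ℂ) (hu : Literature.NumberTheory.Automorphic.IsC2 u) :
    Literature.NumberTheory.Automorphic.IsC2 (fun z => u (UpperHalfPlane.J • z)) ∧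
    ∀ z : UpperHalfPlane,
      Literature.NumberTheory.Automorphic.hypLaplacian (fun w => u (UpperHalfPlane.J • w)) z =
      Literature.NumberTheory.Automorphic.hypLaplacian u (UpperHalfPlane.J • z) :=
  ReflectLaplacianAux.reflect_laplacian_aux u hu

end Summit.Langlands.Langlands.Theorems.QuarterFingerprintDeficit

end
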